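import Summits.CriticalPhenomena.PercolationContinuityZ3.Theorems.PercNearOneGluingNoHeavyLowerTailCertCheckSound
import HarnessLib

/-!
# `NoHeavyLowerTail` (stmt-CriticalPhenomena-4575) — certificate machine add-on: SIGNED POLYNOMIAL rows and targets with a
# polynomial multiplier (Positivstellensatz / LP certificates `M·T = Σ λ·m·g + slack`)

Support file (prover seat `prim-bnk-1`, gen 3; `--supports stmt-CriticalPhenomena-4575`).  Computable definitions + soundness on top of the
reflective checker `…CertCheck` / `…CertCheckSound` (nh-dp-blobmono): `normalize`, `dominated`, `evalT`, `evalT_le_of_dominated`,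
`evalT_normalize`, `evalT_eq_sum_buckets` are REUSED unchanged; no named facts, no sorries.

SHAPE OF CERTIFICATE handled here (the exact LP certificates of the `prim-l12` cell for the polarised row (L1): prim-l12-p6
`cert_L1_thmrows_exact.json`, prim-facecert `FULL_L1_D5_KM2_regionA_THEOREMROWS.json`; and any future cell-law certificate with CUBIC rows):
      `M(x) · T(x)  =  Σ_r  wt_r · x^{mult_r} · g_r(x)  +  (polynomial with nonnegative coefficients)`,
where `T` (target) and the rows `g_r` are SIGNED polynomials in the cell variables (given as a pair of term lists `plus − minus` with natural
coefficients), `M` is a polynomial with natural coefficients, and every row is VALID at the point: `g_r(x) ≥ 0`, i.e. `evalT minus_r ≤ evalT plus_r`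
(rows of Richards–Sahi `E₃` type are cubic, Aas–Gladkov rows quadratic, region rows `x_i − x_j` linear, products `(x_i − x_j)·g` again signed polynomials).
* `monoMul`, `scaleT`, `mulT` — products of monomials / term lists (`evalM_monoMul`, `evalT_scaleT`, `evalT_mulT`); `linT e` = the linear form `Σ_{i∈e} x_i`;
* `SRow` — a signed row with monomial multiplier and weight; `plusS` / `minusS` — the two sides `M·T⁻ + Σ wt·m·g⁺` and `M·T⁺ + Σ wt·m·g⁻`;
* `checkS` (one declaration) / `checkSB nb b` (one BUCKET of monomials per declaration, as in `CertCheck.checkB`) — coefficientwise domination;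
* `soundS`, `soundSB`: check passes + `x ≥ 0` + rows valid ⇒ `0 ≤ M(x) · (T⁺(x) − T⁻(x))`.
The slack never has to be written down (domination absorbs it).  Customer: `…PolarisedRowL1Cert*` (the (L1) certificate over theorem rows).
-/

namespace Summit.CriticalPhenomena.PercolationContinuityZ3.Theorems

namespace CertCheck

/-! ## Products -/

/-- Product of two monomials: insert the variables of the first into the (sorted) second. [folklore] -/
def monoMul (m m' : List ℕ) : List ℕ := m.foldr monoIns m'

/-- Scale a term list by `wt · x^mult`. [folklore] -/
def scaleT (mult : List ℕ) (wt : ℕ) (l : List Term) : List Term := l.map fun t => (monoMul mult t.1, wt * t.2)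

/-- Product of two term lists. [folklore] -/
def mulT (p q : List Term) : List Term := p.flatMap fun t => scaleT t.1 t.2 q

/-- The linear form `Σ_{i ∈ e} x_i` as a term list. [folklore] -/
def linT (e : List ℕ) : List Term := linTerms e [] 1

variable (x : ℕ → ℝ)

/-- Value of a product of monomials. [folklore] -/
theorem evalM_monoMul (m m' : List ℕ) : evalM x (monoMul m m') = evalM x m * evalM x m' := by
  induction m with
  | nil => simp [monoMul, evalM]
  | cons a m ih =>
    show evalM x (monoIns a (m.foldr monoIns m')) = _
    rw [evalM_monoIns]
    unfold monoMul at ih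
    rw [ih]
    simp only [evalM, List.map_cons, List.prod_cons]
    ring

/-- Value of a scaled term list. [folklore] -/
theorem evalT_scaleT (mult : List ℕ) (wt : ℕ) (l : List Term) :
    evalT x (scaleT mult wt l) = (wt : ℝ) * evalM x mult * evalT x l := by
  induction l with
  | nil => simp [scaleT, evalT]
  | cons t l ih =>
    unfold scaleT at ih ⊢
    rw [List.map_cons, evalT_cons, evalT_cons, ih, evalM_monoMul]
    push_cast
    ring

/-- Value of a product of term lists. [folklore] -/
theorem evalT_mulT (p q : List Term) : evalT x (mulT p q) = evalT x p * evalT x q := by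
  induction p with
  | nil => simp [mulT, evalT]
  | cons t p ih =>
    unfold mulT at ih ⊢
    rw [List.flatMap_cons, evalT_append, ih, evalT_scaleT, evalT_cons]
    ring

/-- Value of the linear form. [folklore] -/
theorem evalT_linT (e : List ℕ) : evalT x (linT e) = linEval x e := by
  unfold linT
  rw [evalT_linTerms]
  simp [evalM]

/-! ## Signed rows, the two sides, the check -/

/-- A signed polynomial row `wt · x^mult · (plus − minus)` (used under the hypothesis `plus(x) ≥ minus(x)`). [folklore] -/
structure SRow where
  /-- positive part of the row polynomial -/
  plus : List Term
  /-- negative part of the row polynomial -/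
  minus : List Term
  /-- monomial multiplier -/
  mult : List ℕ
  /-- nonnegative integer weight -/
  wt : ℕ

/-- The side to be dominated: `M·T⁻ + Σ_r wt_r·m_r·g_r⁺`. [folklore] -/
def plusS (M tminus : List Term) (rows : List SRow) : List Term :=
  mulT M tminus ++ rows.flatMap fun r => scaleT r.mult r.wt r.plus

/-- The dominating side: `M·T⁺ + Σ_r wt_r·m_r·g_r⁻`. [folklore] -/
def minusS (M tplus : List Term) (rows : List SRow) : List Term :=
  mulT M tplus ++ rows.flatMap fun r => scaleT r.mult r.wt r.minus

/-- THE CHECK (one declaration): coefficientwise domination after normalisation. [folklore] -/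
def checkS (M tplus tminus : List Term) (rows : List SRow) : Bool :=
  dominated (normalize (plusS M tminus rows)) (normalize (minusS M tplus rows))

/-- THE BUCKETED CHECK: domination restricted to the monomials of bucket `b` (one declaration per bucket). [folklore] -/
def checkSB (nb b : ℕ) (M tplus tminus : List Term) (rows : List SRow) : Bool :=
  dominated (normalize ((plusS M tminus rows).filter fun t => bucket nb t == b))
    (normalize ((minusS M tplus rows).filter fun t => bucket nb t == b))

/-! ## Soundness -/

/-- Core step: domination of the two sides at a nonnegative point with valid rows gives `0 ≤ M·(T⁺ − T⁻)`. [folklore] -/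
theorem nonneg_of_plusS_le_minusS (hx : ∀ i, 0 ≤ x i) (M tplus tminus : List Term) (rows : List SRow)
    (hrows : ∀ r ∈ rows, evalT x r.minus ≤ evalT x r.plus)
    (hdom : evalT x (plusS M tminus rows) ≤ evalT x (minusS M tplus rows)) :
    0 ≤ evalT x M * (evalT x tplus - evalT x tminus) := by
  unfold plusS minusS at hdom
  rw [evalT_append, evalT_append, evalT_mulT, evalT_mulT, evalT_flatMap, evalT_flatMap] at hdom
  simp only [evalT_scaleT] at hdom
  have hR : (rows.map fun r => (r.wt : ℝ) * evalM x r.mult * evalT x r.minus).sum ≤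
      (rows.map fun r => (r.wt : ℝ) * evalM x r.mult * evalT x r.plus).sum :=
    List.sum_le_sum fun r hr => mul_le_mul_of_nonneg_left (hrows r hr) (mul_nonneg (Nat.cast_nonneg _) (evalM_nonneg x hx _))
  rw [mul_sub]
  linarith

/-- **Soundness of `checkS`.** [folklore] -/
theorem soundS (hx : ∀ i, 0 ≤ x i) (M tplus tminus : List Term) (rows : List SRow)
    (hrows : ∀ r ∈ rows, evalT x r.minus ≤ evalT x r.plus) (h : checkS M tplus tminus rows = true) :
    0 ≤ evalT x M * (evalT x tplus - evalT x tminus) := by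
  refine nonneg_of_plusS_le_minusS x hx M tplus tminus rows hrows ?_
  have := evalT_le_of_dominated x hx _ _ h
  rwa [evalT_normalize, evalT_normalize] at this

/-- **Soundness of the bucketed check**: if every bucket `b < nb` passes `checkSB`, the conclusion of `soundS` holds. [folklore] -/
theorem soundSB (hx : ∀ i, 0 ≤ x i) (M tplus tminus : List Term) (rows : List SRow) {nb : ℕ} (hnb : 0 < nb)
    (hrows : ∀ r ∈ rows, evalT x r.minus ≤ evalT x r.plus) (h : ∀ b < nb, checkSB nb b M tplus tminus rows = true) :
    0 ≤ evalT x M * (evalT x tplus - evalT x tminus) := by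
  refine nonneg_of_plusS_le_minusS x hx M tplus tminus rows hrows ?_
  rw [evalT_eq_sum_buckets x hnb (plusS M tminus rows), evalT_eq_sum_buckets x hnb (minusS M tplus rows)]
  apply List.sum_le_sum
  intro b hb
  have := evalT_le_of_dominated x hx _ _ (h b (List.mem_range.1 hb))
  rwa [evalT_normalize, evalT_normalize] at this

/-! ## Row shapes: Aas–Gladkov `qt − e₂`, the homogeneous Richards–Sahi `E₃`, regions, and their products -/

/-- Positive part of an Aas–Gladkov row `m(Q)·m(T)`. [folklore] -/
def agPlus (Q T : List ℕ) : List Term := mulT (linT Q) (linT T)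

/-- Negative part of an Aas–Gladkov row `e₂(U) = m(U₁)m(U₂) + m(U₁)m(U₃) + m(U₂)m(U₃)`. [folklore] -/
def agMinus (U₁ U₂ U₃ : List ℕ) : List Term :=
  mulT (linT U₁) (linT U₂) ++ mulT (linT U₁) (linT U₃) ++ mulT (linT U₂) (linT U₃)

/-- Positive part of the homogeneous Richards–Sahi form `2σ²·m(ABC) + m(A)m(B)m(C)` (`σ` = total mass as a linear form). [folklore] -/
def e3Plus (σ A B C ABC : List ℕ) : List Term :=
  scaleT [] 2 (mulT (linT σ) (mulT (linT σ) (linT ABC))) ++ mulT (linT A) (mulT (linT B) (linT C))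

/-- Negative part `σ·(m(A)m(BC) + m(B)m(AC) + m(C)m(AB))`. [folklore] -/
def e3Minus (σ A B C AB AC BC : List ℕ) : List Term :=
  mulT (linT σ) (mulT (linT A) (linT BC) ++ mulT (linT B) (linT AC) ++ mulT (linT C) (linT AB))

/-- Value of `agPlus`. [folklore] -/
theorem evalT_agPlus (Q T : List ℕ) : evalT x (agPlus Q T) = linEval x Q * linEval x T := by
  simp [agPlus, evalT_mulT, evalT_linT]

/-- Value of `agMinus`. [folklore] -/
theorem evalT_agMinus (U₁ U₂ U₃ : List ℕ) :
    evalT x (agMinus U₁ U₂ U₃) = linEval x U₁ * linEval x U₂ + linEval x U₁ * linEval x U₃ + linEval x U₂ * linEval x U₃ := by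
  simp only [agMinus, evalT_append, evalT_mulT, evalT_linT]

/-- Value of `e3Plus`. [folklore] -/
theorem evalT_e3Plus (σ A B C ABC : List ℕ) :
    evalT x (e3Plus σ A B C ABC) = 2 * linEval x σ ^ 2 * linEval x ABC + linEval x A * linEval x B * linEval x C := by
  simp [e3Plus, evalT_append, evalT_mulT, evalT_linT, evalT_scaleT, evalM]
  ring

/-- Value of `e3Minus`. [folklore] -/
theorem evalT_e3Minus (σ A B C AB AC BC : List ℕ) :
    evalT x (e3Minus σ A B C AB AC BC) =
      linEval x σ * (linEval x A * linEval x BC + linEval x B * linEval x AC + linEval x C * linEval x AB) := by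
  simp only [e3Minus, evalT_append, evalT_mulT, evalT_linT]

/-- Product of a signed row `(p⁺, p⁻)` with a region factor `x_i − x_j`: positive part `x_i p⁺ + x_j p⁻`. [folklore] -/
def regPlus (i j : ℕ) (plus minus : List Term) : List Term := scaleT [i] 1 plus ++ scaleT [j] 1 minus

/-- … negative part `x_i p⁻ + x_j p⁺`. [folklore] -/
def regMinus (i j : ℕ) (plus minus : List Term) : List Term := scaleT [i] 1 minus ++ scaleT [j] 1 plus

/-- Value identity: `regPlus − regMinus = (x_i − x_j)·(p⁺ − p⁻)`. [folklore] -/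
theorem evalT_regPlus_sub (i j : ℕ) (plus minus : List Term) :
    evalT x (regPlus i j plus minus) - evalT x (regMinus i j plus minus) = (x i - x j) * (evalT x plus - evalT x minus) := by
  simp [regPlus, regMinus, evalT_append, evalT_scaleT, evalM]
  ring

/-- A product row is valid when both factors are nonnegative. [folklore] -/
theorem reg_row_valid {i j : ℕ} {plus minus : List Term} (hij : x j ≤ x i) (hp : evalT x minus ≤ evalT x plus) :
    evalT x (regMinus i j plus minus) ≤ evalT x (regPlus i j plus minus) := by
  have h := evalT_regPlus_sub x i j plus minus
  nlinarith [mul_nonneg (sub_nonneg.2 hij) (sub_nonneg.2 hp)]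

/-- Tiny self-test: `x₀·(x₀ − 0) ≥` nothing; `checkS` on `M = x₀`, `T = x₀x₁ − 0`, one row `x₀x₁ ≥ 0`-shaped data evaluates. [folklore] -/
example : checkS [([0], 1)] [([0, 1], 1)] [] [⟨[([1], 1)], [], [0, 0], 1⟩] = true := by decide

end CertCheck

end Summit.CriticalPhenomena.PercolationContinuityZ3.Theorems
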